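import Summits.BirchSwinnertonDyer.BirchSwinnertonDyer.Theorems.RamifiedHeegnerPairGss2LowerAtThreeRankOneKolyvaginRoad
import Summits.BirchSwinnertonDyer.BirchSwinnertonDyer.Theorems.AdditiveKolyvaginRoadIstarIsogenyInvariance
import Summits.BirchSwinnertonDyer.BirchSwinnertonDyer.Theorems.AdditiveKolyvaginRoadManinFrameFromDatum
import Summits.BirchSwinnertonDyer.BirchSwinnertonDyer.Theses.RamifiedHeegnerPair
import Summits.BirchSwinnertonDyer.Rank1Residual.O5.GssTwistDictionary
import Summits.BirchSwinnertonDyer.Rank1Residual.X11b.Three.StepLAtThree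
import Literature.NumberTheory.EllipticCurves.ManinConstantClassCertificateTwist
import Literature.NumberTheory.EllipticCurves.LeadingTermProofs
import HarnessLib

/-!
# Route `RamifiedHeegnerPair`, deciding crux L₁ `Gss2LowerAtThreeRankOne` (stmt-BirchSwinnertonDyer-26021) BY NAME of the
# tree's typed REFINED KOLYVAGIN CONJECTURE at an additive `3`: L₁ on the tower rows ⟸ print ∧ Kolyvagin's structure theorem
# (lower one-class form) ∧ `AdditiveThree.RKC3Indivisibility` (cell b2b/o5o6, T1⁻)

HONEST FRAMING. Theorems only; helper file (`--supports stmt-BirchSwinnertonDyer-26021 --as helper`); no definition, no named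
fact, no `sorry`; nothing is booked, no item is closed, BSD is not proved for any curve; CONDITIONAL on every displayed input.
Lead prover bsd-line-rhp-p1 g3, 2026-08-28. Sequel of p610432 / p610796 / p611832.

WHAT. The road's load-bearing input (skeleton v2 `stub_existsAdjustedStepL_towerRows`: ONE split Heegner datum per Gss2
rank-one tower row carrying the BSD-consistent adjusted STEP L at `3`) is supplied here from TWO typed statements of the tree's
o5o6 file `Rank1Residual/Additive/WildThreeRefinedKolyvagin.lean` and print:

* `AdditiveThree.RKC3Indivisibility` (T1⁻, `@[conjecture]`): for `E` additive at `3` (`9 ∣ N_E`) with `ρ_{E,3^∞}` onto, every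
  Heegner `K′` (`d_{K′} ∉ {−3,−4}`) with `ord_{s=1} L(E/K′,s) = 1`, every datum `Dt` at level `N_E` with `3 ∤ c(Dt)` and every
  admissible `β`: SOME genuine Kolyvagin class is not `3^{t+1}`-divisible, `t = ord₃ ∏_ℓ c_ℓ(E)` — the Zhang / BCGS half of
  the refined Kolyvagin conjecture READ at an additive `3` (OPEN; per-pair certifiable);
* `AdditiveThree.OneClassLowerBoundShape`: Kolyvagin's structure theorem at `3`, lower one-class form (McCallum 1991 Thm.
  5.4/5.8; print-shaped, `p ∣ N` reading flagged by its typer);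
* print: Gross–Zagier, Kolyvagin, Kato 14.5(3)+14.16(2) Tamagawa-exact, GZK, modularity (analytic continuation; a newform;
  Friedberg–Hoffstein's split Heegner field with `L(E^{(d_{K′})},1) ≠ 0`), and the MANIN-UNIT DATUM at an additive prime of
  Kodaira type `Iₙ*` (Mazur 1978 / Abbes–Ullmo 1996 / Česnavičius 2018 on the isogeny class, cite-only binders `hMz hAU hC2`,
  through the AKR lane's Theses-free `ManinFrameFromDatum` / `IstarIsogenyInvariance`; (G) ∧ ss IS `I₀*` at `3`).

The budget matches because `2t ≤ t + ord₃∏c(Wd) + 2·ord₃ c(Dt)` by the all-`p` inequality `ord₃∏c(E) ≤ ord₃∏c(E^{(d_{K′})})`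
(`HeegnerKolyvagin.padicValNat_tamagawaProduct_le_twist_of_heegner`). So:

* §8 `exists_kodairaSymbolAt_eq_Istar_three_of_subGss` — (G) ∧ ss at `3` is of Kodaira type `Iₙ*` at the place `3` of `ℤ`
  (k1-c3x `exists_kodairaSymbolAt_eq_Istar_of_subGss` at `p = 3`, re-derived over Theses-free modules);
* §9 `gssLowerAtThree_rankOne_towerRows_of_structure_of_rkc3Indivisibility` — L₁ on the tower rows ⟸ print ∧ structure ∧ T1⁻;
* §10 `gss2LowerAtThreeRankOne_of_structure_of_rkc3Indivisibility_of_nonTower` — the crux BY NAME, non-tower rows displayed.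

PLANNER'S READING: on the tower rows, 26021 ⟸ {print} ∧ `OneClassLowerBoundShape` ∧ `RKC3Indivisibility|Gss2, r_an = 1`; dually
rhp-p2's 26022 ⟸ {print} ∧ structure (upper form) ∧ `RKC3Divisibility`-shape ∧ L₀ of the twist (p607034). CONDITIONAL; every
∀-statement stays OPEN. References: [cite: WZhang2014, Thm. 1.1, §3.8, Thm. 10.2, Remark 18] [cite: Jetchev2008, Conj. 1.3,
Thm. 1.4] [cite: McCallumLMS1991, Thm. 5.4 (p. 288), Thm. 5.8 (p. 290)] [cite: JetchevSkinnerWan2017, §7.4.1 (pp. 29–31)]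
[cite: Kato2004Asterisque, Thm. 14.5 (3) (p. 236)] [cite: Mazur1978, Cor. 4.1] [cite: AbbesUllmo1996, Thm. A]
[cite: Cesnavicius2018, Thm. 1.2] [cite: Darmon2004, Thm. 3.6] [cite: SilvermanATAEC1994, IV.9.4 Steps 6–7]
[cite: FriedbergHoffstein1995, Thm. B] [cite: Miller2011LMS, Def. 1.1].
-/

-- D-0017: single-problem summit, so `Summit.BirchSwinnertonDyer.BirchSwinnertonDyer.…` repeats a namespace BY DESIGN.
set_option linter.dupNamespace false
set_option autoImplicit false

noncomputable section

open scoped Classical NumberField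

open WeierstrassCurve NumberField IsDedekindDomain IsDedekindDomain.HeightOneSpectrum Rat.HeightOneSpectrum
  Literature.NumberTheory.DiophantineGeometry Literature.NumberTheory.EllipticCurves
  Literature.NumberTheory.EllipticCurves.ModularForms Literature.NumberTheory.EllipticCurves.Rank1Residual
  Literature.NumberTheory.EllipticCurves.Rank1Residual.Typed Literature.NumberTheory.Automorphic
  Summit.BirchSwinnertonDyer.Rank1Residual Summit.BirchSwinnertonDyer.Rank1Residual.Additive
  Summit.BirchSwinnertonDyer.Rank1Residual.X11b Summit.BirchSwinnertonDyer.Rank1Residual.GaloisImage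
  Summit.BirchSwinnertonDyer.BirchSwinnertonDyer.Theorems
  Summit.BirchSwinnertonDyer.BirchSwinnertonDyer.Theorems.AdditiveBranchIMCGordTwoRankOne

namespace Summit.BirchSwinnertonDyer.BirchSwinnertonDyer.Theorems.RamifiedPairLowerBound

/-! ## §8 (G) ∧ ss at `3` is of Kodaira type `Iₙ*` at the place `3` -/

/-- **Cell (G) ∧ ss is of Kodaira type `Iₙ*` at the place of `ℤ` under `3`** — k1-c3x
`HeegnerKolyvagin.exists_kodairaSymbolAt_eq_Istar_of_subGss` (Part 23b §13, route `AdditiveBranchIMC`) at `p = 3`, re-derived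
verbatim over the Theses-free modules it uses (o5's supply of a globally minimal GOOD model `V` of `E^{(−3)}`; `W ≅ C • V^{(−3)}`
with `3 ∥ −3`, so Tate's algorithm Steps 6–7 return `Iₙ*`). [cite: SilvermanATAEC1994, IV.9.4 Steps 6–7 (PDF pp. 345–346) and Table 4.1]
[cite: Delbourgo1998, §1.5 (G)] -/
theorem exists_kodairaSymbolAt_eq_Istar_three_of_subGss
    (W : WeierstrassCurve ℚ) [W.IsElliptic] [W.IsGloballyMinimal] (hadd : Addv W 3) (hss : SubGss W 3) :
    ∃ (v : HeightOneSpectrum ℤ) (n : ℕ), natGenerator v = 3 ∧ W.kodairaSymbolAt v = .Istar n := by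
  -- adapted from k1-c3x `exists_kodairaSymbolAt_eq_Istar_of_subGss` (…HeegnerKolyvaginIstarDoors.lean §13), `p := 3`
  have hp : (3 : ℕ).Prime := Nat.prime_three
  have hp2 : (3 : ℕ) ≠ 2 := by decide
  obtain ⟨V, _, _, C, hC, hgood⟩ := O5.exists_goodSS_twist_pStar_of_subGss W 3 hp2 hadd hss
  have hVgood : V.HasGoodReductionAtPrime 3 := hgood.1
  set d : ℤ := (-1 : ℤ) ^ (3 / 2) * 3 with hd
  obtain ⟨hd0, h1, h2⟩ := IstarIsogenyInvariance.pStar_dvd_facts hp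
  have hdQ : ((d : ℤ) : ℚ) = (-1 : ℚ) ^ (3 / 2) * 3 := by push_cast [hd]; ring
  have hd0Q : (d : ℚ) ≠ 0 := by exact_mod_cast hd0
  have hC' : C • W.quadraticTwist (d : ℚ) = V := by rw [hdQ]; exact_mod_cast hC
  obtain ⟨C', hC'W⟩ := exists_variableChange_quadraticTwist_symm V W hd0Q ⟨C, hC'⟩
  set v' : HeightOneSpectrum (𝓞 ℚ) := (primesEquiv (R := 𝓞 ℚ)).symm ⟨3, hp⟩ with hv'
  have hkey : primesEquiv v' = ⟨3, hp⟩ := (primesEquiv (R := 𝓞 ℚ)).apply_symm_apply _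
  have hvnat : ((primesEquiv v' : Nat.Primes) : ℕ) = 3 := congrArg Subtype.val hkey
  have hv2 : ((primesEquiv v' : Nat.Primes) : ℕ) ≠ 2 := by rw [hvnat]; exact hp2
  have hVv : V.HasGoodReductionAt v' := by
    have hiff := hasGoodReductionAtPrime_iff_hasGoodReductionAt_ringOfIntegers v' V
    simp only [hkey] at hiff
    exact hiff.mp hVgood
  obtain ⟨n, hn⟩ := Additive.kodairaSymbolAt_twist_of_semistable v' V hv2 hd0
    (by rw [hvnat]; exact h1) (by rw [hvnat]; exact h2) (Or.inl hVv) C' hC'W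
  set v : HeightOneSpectrum ℤ := (primesEquiv (R := ℤ)).symm ⟨3, hp⟩ with hv
  have hkeyZ : primesEquiv v = ⟨3, hp⟩ := (primesEquiv (R := ℤ)).apply_symm_apply _
  have hvv' : primesEquiv v = primesEquiv v' := by rw [hkeyZ, hkey]
  refine ⟨v, n, congrArg Subtype.val hkeyZ, ?_⟩
  rw [O5.FlexNormalForm.kodairaSymbolAt_eq_of_primesEquiv_eq' W v v' hvv']
  exact hn

/-! ## §9 L₁ on the tower rows from print ∧ structure (lower form) ∧ `RKC3Indivisibility` -/

/-- **L₁ on the 3-adic-tower rows of the Gss2 leaf ⟸ print ∧ `OneClassLowerBoundShape` ∧ `RKC3Indivisibility`.** PRINT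
binders: `hGZ hKo hKatoT hGZK hmod` (as in §5), `hnf` (a newform: root number, optimal curve), `hFH` (Friedberg–Hoffstein),
`hMz hAU hC2` (Manin constant of the optimal curve: Mazur 1978, Abbes–Ullmo 1996, Česnavičius 2018 — cite-only). TYPED inputs:
`hSL : AdditiveThree.OneClassLowerBoundShape`, `hT1 : AdditiveThree.RKC3Indivisibility`. CONCLUSION: `Typed.MissingLowerBoundAt E 3`
for every globally minimal `E` additive (G) ∧ ss at `3`, `r_an(E) = 1`, `ρ_{E,3^n}` onto for all `n`. Chain: FH field `K′`
(`|d_{K′}| > 4`, so `d_{K′} ∉ {−3,−4}`); (G) ∧ ss is `I₀*` at `3` (§8) so the class carries a datum `Dt` with `3 ∤ c(Dt)`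
(`ManinFrameFromDatum`); `ord_{s=1} L(E/K′,s) = r_an(E) + r_an(E^{d_{K′}}) = 1 + 0`; `hT1` ⟹ a Kolyvagin class of the datum not
`3^{t+1}`-divisible, `t = ord₃∏c(E)`; the budget `2t ≤ t + ord₃∏c(Wd) + 2·ord₃ c(Dt)` holds by `ord₃∏c(E) ≤ ord₃∏c(Wd)`; §2 gives
the adjusted STEP L at the datum and §0 the lower half. [cite: WZhang2014, Thm. 1.1 and Remark 18] [cite: Jetchev2008, Conj. 1.3]
[cite: McCallumLMS1991, Thm. 5.4 (p. 288)] [cite: Mazur1978, Cor. 4.1] [cite: AbbesUllmo1996, Thm. A] [cite: Cesnavicius2018, Thm. 1.2]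
[cite: JetchevSkinnerWan2017, §7.4.1 (pp. 29–31)] [cite: FriedbergHoffstein1995, Thm. B] -/
theorem gssLowerAtThree_rankOne_towerRows_of_structure_of_rkc3Indivisibility
    (hGZ : ∀ (N : ℕ) [NeZero N] (W : WeierstrassCurve ℚ) (K : Type) [Field K] [NumberField K],
      gross_zagier N W K)
    (hKo : ∀ (N : ℕ) [NeZero N] (W : WeierstrassCurve ℚ) (K : Type) [Field K] [NumberField K],
      kolyvagin N W K)
    (hKatoT : Kato2004.rankZero_padicValNat_sha_add_padicValNat_tamagawa_le_of_additive_potGood_of_imageContainsSL2)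
    (hGZK : rank_eq_analyticRank_of_analyticRank_le_one) (hmod : hasEntireLFunction_rat)
    (hnf : exists_isNewformOf) (hFH : friedbergHoffstein_exists_heegnerField_split_twist_ne_zero)
    (hMz : mazur_not_dvd_maninConstant_of_odd)
    (hAU : abbesUllmo_not_dvd_maninConstant_of_not_dvd_level)
    (hC2 : cesnavicius_not_two_dvd_maninConstant_of_two_dvd_level)
    (hSL : AdditiveThree.OneClassLowerBoundShape) (hT1 : AdditiveThree.RKC3Indivisibility) :
    ∀ (W : WeierstrassCurve ℚ) [W.IsElliptic] [W.IsGloballyMinimal],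
      Addv W 3 → SubGss W 3 → W.analyticRank = 1 →
      (∀ n : ℕ, W.HasSurjectiveModNGaloisRep (3 ^ n : ℕ)) → MissingLowerBoundAt W 3 := by
  intro W _ _ hadd hsub hr hsurj
  haveI : Fact (Nat.Prime 3) := ⟨Nat.prime_three⟩
  haveI hN0 : NeZero (W.conductorNorm ℤ) := ⟨(W.conductorNorm_pos_holds).ne'⟩
  have hp2 : (3 : ℕ) ≠ 2 := by decide
  -- the row: `9 ∣ N`, tower, `E[3]` irreducible
  have h9 : 9 ∣ W.conductorNorm ℤ := by
    simpa using (sq_dvd_conductorNorm_of_not_good_of_not_mult (V := W) (q := 3) hadd)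
  have htower : AdditiveThree.TowerSurjThree W := fun n _ ↦ hsurj n
  have hirr : Irr W 3 := by
    haveI : NeZero ((3 : ℕ) : ℚ) := ⟨by norm_num⟩
    exact hasIrreducibleModPGaloisRep_of_hasSurjectiveModNGaloisRep W 3 (by simpa using hsurj 1)
  -- the field (Friedberg–Hoffstein): every `ℓ ∣ N` split, `|d_K| > 4`, `L(E^{d_K},1) ≠ 0`
  have hw : W.rootNumber = -1 := by
    rw [WeierstrassCurve.rootNumber_eq_neg_one_pow_analyticRank_of_exists_isNewformOf hnf W, hr]
    norm_num
  obtain ⟨K, _, _, hK, hdisc, hHN, -, hLt⟩ := hFH W hw 3 Nat.prime_three 4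
  have h3N : 3 ∣ W.conductorNorm ℤ :=
    (W.dvd_conductorNorm_iff_not_hasGoodReductionAtPrime 3).mpr (not_good_of_addv W 3 hadd)
  obtain ⟨hd3, hμ⟩ := X11b.Three.not_dvd_discr_and_not_dvd_torsionOrder_of_heegner hK hHN hp2 h3N
  have h3 : NumberField.discr K ≠ -3 := fun h ↦ hd3 (h ▸ ⟨-1, by norm_num⟩)
  have h4 : NumberField.discr K ≠ -4 := by
    haveI : IsTotallyComplex K := hK.2
    have hneg : NumberField.discr K < 0 := discr_neg_of_finrank_eq_two K hK.1
    have habs : ((NumberField.discr K).natAbs : ℤ) = -NumberField.discr K := Int.ofNat_natAbs_of_nonpos hneg.le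
    have : (4 : ℤ) < ((NumberField.discr K).natAbs : ℤ) := by exact_mod_cast hdisc
    omega
  -- the Manin-unit datum: (G) ∧ ss is `I₀*` at `3`, on the whole isogeny class
  obtain ⟨v, n, hv, hKod⟩ := exists_kodairaSymbolAt_eq_Istar_three_of_subGss W hadd hsub
  obtain ⟨Dt, H, ι, P, hP, hc⟩ := ManinFrameFromDatum.exists_maninDatum_of_exists_not_dvd W 3 (W.conductorNorm ℤ) K
    (ManinFrameFromDatum.exists_modularParametrizationData_not_dvd_of_istarClass hnf hMz hAU hC2 W rfl 3 hp2 hirr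
      (IstarIsogenyInvariance.istarClass_of_kodairaSymbolAt_eq_Istar hp2 v hv hKod)) hK hHN
  -- a globally minimal model of the twist
  have hD0 : (NumberField.discr K : ℚ) ≠ 0 := by exact_mod_cast NumberField.discr_ne_zero K
  haveI hEt : (W.quadraticTwist (NumberField.discr K : ℚ)).IsElliptic := W.isElliptic_quadraticTwist hD0
  obtain ⟨Cd, hCd⟩ := hasGlobalMinimalModel_rat_holds (W.quadraticTwist (NumberField.discr K : ℚ))
  haveI : (Cd • W.quadraticTwist (NumberField.discr K : ℚ)).IsGloballyMinimal := hCd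
  set Wd := Cd • W.quadraticTwist (NumberField.discr K : ℚ) with hWd_def
  have hWd : Cd • W.quadraticTwist (NumberField.discr K : ℚ) = Wd := rfl
  -- `ord_{s=1} L(E/K,s) = 1`
  have hrEK : analyticRankEK W K = 1 := by
    have hrt : (W.quadraticTwist (NumberField.discr K : ℚ)).analyticRank = 0 :=
      ((W.quadraticTwist (NumberField.discr K : ℚ)).analyticRank_eq_zero_iff_holds (hmod _)).2 hLt
    rw [analyticRankEK_eq_add_holds_of hmod W K, hr, hrt]
  -- the Heegner point is non-torsion (Gross–Zagier)
  have hL0 : W.entireLFunction 1 = 0 := entireLFunction_one_eq_zero_of_analyticRank_eq_one hr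
  obtain ⟨-, hderiv⟩ := leadingLCoeff_eq_deriv_of_analyticRank_eq_one hr
  have hLK : LDerivEK W K ≠ 0 := by
    rw [KrizLi2019.lDerivEK_eq_deriv_mul W K hmod hL0]; exact mul_ne_zero hderiv hLt
  have hnt : ¬ IsOfFinAddOrder P :=
    (lDerivEK_ne_zero_iff_not_isOfFinAddOrder W (W.conductorNorm ℤ) K (hGZ _ W K) hK hHN ⟨Dt, H, ι, hP⟩).mp hLK
  -- T1⁻ at the datum: ONE genuine class not `3^{t+1}`-divisible, `t = ord₃ ∏c(E)`
  have hInd : ¬ AdditiveThree.MinftyGe W K Dt H.β ι (padicValNat 3 W.tamagawaProduct + 1) :=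
    hT1 W h9 htower K hK h3 h4 hHN hrEK Dt H.β ι H.dvd_sq_sub hc
  -- the budget: `2t ≤ t + ord₃∏c(Wd) + 2·ord₃ c` since `ord₃∏c(E) ≤ ord₃∏c(Wd)`
  have htam : padicValNat 3 W.tamagawaProduct ≤ padicValNat 3 Wd.tamagawaProduct :=
    HeegnerKolyvagin.padicValNat_tamagawaProduct_le_twist_of_heegner W 3 K hK hHN Cd hWd
  have hbudget : 2 * padicValNat 3 W.tamagawaProduct ≤ padicValNat 3 W.tamagawaProduct +
      padicValNat 3 Wd.tamagawaProduct + 2 * padicValNat 3 Dt.c.natAbs := by omega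
  -- §2: the adjusted STEP L at the datum; §0: the lower half
  exact missingLowerBoundAt_three_rankOne_gss_of_adjustedIndexBound W K Dt H ι P (hGZ _ W K) (hKo _ W K) hKatoT hGZK hmod
    hadd hsub hr hsurj hK hHN hP hμ hLt Wd Cd hWd fun _ ↦
      adjustedIndexBound_three_of_oneClassLowerBound_of_not_minftyGe hSL W hsurj K hK h3 h4 hHN Dt H ι P hP hnt Wd
        ⟨padicValNat 3 W.tamagawaProduct, hbudget, hInd⟩

/-! ## §10 The crux BY NAME from print ∧ structure ∧ `RKC3Indivisibility`, non-tower rows displayed -/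

/-- **26021 BY NAME ⟸ print ∧ `OneClassLowerBoundShape` ∧ `RKC3Indivisibility` ∧ [L₁ on the non-tower rows].** The split by
the 3-adic image; closes nothing; BSD is not proved by this. [cite: WZhang2014, Thm. 1.1 and Remark 18]
[cite: McCallumLMS1991, Thm. 5.4 (p. 288)] [cite: JetchevSkinnerWan2017, §7.4.1 (pp. 29–31)] [cite: Miller2011LMS, Def. 1.1] -/
theorem gss2LowerAtThreeRankOne_of_structure_of_rkc3Indivisibility_of_nonTower
    (hGZ : ∀ (N : ℕ) [NeZero N] (W : WeierstrassCurve ℚ) (K : Type) [Field K] [NumberField K],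
      gross_zagier N W K)
    (hKo : ∀ (N : ℕ) [NeZero N] (W : WeierstrassCurve ℚ) (K : Type) [Field K] [NumberField K],
      kolyvagin N W K)
    (hKatoT : Kato2004.rankZero_padicValNat_sha_add_padicValNat_tamagawa_le_of_additive_potGood_of_imageContainsSL2)
    (hGZK : rank_eq_analyticRank_of_analyticRank_le_one) (hmod : hasEntireLFunction_rat)
    (hnf : exists_isNewformOf) (hFH : friedbergHoffstein_exists_heegnerField_split_twist_ne_zero)
    (hMz : mazur_not_dvd_maninConstant_of_odd)
    (hAU : abbesUllmo_not_dvd_maninConstant_of_not_dvd_level)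
    (hC2 : cesnavicius_not_two_dvd_maninConstant_of_two_dvd_level)
    (hSL : AdditiveThree.OneClassLowerBoundShape) (hT1 : AdditiveThree.RKC3Indivisibility)
    (hNT : ∀ (W : WeierstrassCurve ℚ) [W.IsElliptic] [W.IsGloballyMinimal],
      ¬ W.HasCM → Addv W 3 → SubGss W 3 → W.analyticRank = 1 →
      ¬ (∀ n : ℕ, W.HasSurjectiveModNGaloisRep (3 ^ n : ℕ)) → MissingLowerBoundAt W 3) :
    Summit.BirchSwinnertonDyer.BirchSwinnertonDyer.Theses.RamifiedHeegnerPair.Gss2LowerAtThreeRankOne := by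
  intro W _ _ hCM hadd hsub hr
  by_cases hρ : ∀ n : ℕ, W.HasSurjectiveModNGaloisRep (3 ^ n : ℕ)
  · exact gssLowerAtThree_rankOne_towerRows_of_structure_of_rkc3Indivisibility hGZ hKo hKatoT hGZK hmod hnf hFH hMz hAU hC2 hSL
      hT1 W hadd hsub hr hρ
  · exact hNT W hCM hadd hsub hr hρ

end Summit.BirchSwinnertonDyer.BirchSwinnertonDyer.Theorems.RamifiedPairLowerBound

end
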